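import Summits.CriticalPhenomena.PercolationContinuityZ3.Theorems.PercNearOneGluingNoHeavyPcintMemAutomatonExact
import Summits.CriticalPhenomena.PercolationContinuityZ3.Theorems.PercNearOneGluingNoHeavyPcintMemCertSym
import Summits.CriticalPhenomena.PercolationContinuityZ3.Theorems.PercNearOneGluingNoHeavyPcintLoopExclusionLaw
import HarnessLib

/-!
# CriticalPhenomena/PercolationContinuityZ3 — Theorems/PercNearOneGluingNoHeavyPcintClosingCountKernel.lean: the closing counts `2τ·p_τ(ℤ^d)` by KERNEL EVALUATION of the exact automaton — `closingCount 3 6 = 264`, `closingCount 4 6 = 912`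

Lane prim-pcint, STRUCTURE rule (infrastructure for the second-rung densities `f_τ = closingCount/μ_{τ−2}^τ` of the typed law C4).
The dangerous-set automaton `mstep τ` accepts exactly the memory-`τ` words and ends in the dangerous set (`runW_mstep_of_isMem`,
`isMem_of_runW_isSome`, …PcintMemAutomaton / …PcintMemAutomatonExact).  A `(τ−1)`-letter word is a closing self-avoiding word
(`∈ nearWords d τ (τ−1)`, counted by `closingCount d τ = 2τ·p_τ`) iff it is accepted and its final state still remembers the
START site (an entry of age `τ−1`, necessarily at distance `1`): **`mem_nearWords_iff_runW`**.  Counting accepted words with a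
final-state predicate by the first-letter recursion `cntP` (`card_filter_acceptedP_eq_cntP`, the `P`-version of
`card_accepted_eq_cnt`) gives **`closingCount_eq_cntP : closingCount d τ = cntP (mstep τ) (age τ−1 present) ∅ (τ−1)`** for every
`d` and `τ ≥ 2`, a closed term the kernel evaluates: **`closingCount_six_zd3 : closingCount 3 6 = 264`** and
**`closingCount_six_zd4 : closingCount 4 6 = 912`** (`decide +kernel`; 7776 resp. 32768 words) — the EXACT hexagon counts
`2·6·p_6(ℤ³) = 264`, `2·6·p_6(ℤ⁴) = 912` (so `p_6 = 22`, `76`), matching the general lower bound `closingCount_six_ge` of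
…PcintClosingHexagons with equality.  Consumers: exact `f_6(ℤ³)`, `f_6(ℤ⁴)`, hence LOWER bounds on `R_6` and clause (b) of C4 at
the second rung (…RungSixZ3 / …RungSixZ4).

HONEST FRAMING: bookkeeping + two kernel evaluations; nothing here is used by a certified `p_c` cell.  Written by prim-pcint-2
gen 17 (prover-prim-pcint-2-g17-0), 2026-08-25.
-/

namespace Summit.CriticalPhenomena.PercolationContinuityZ3.Theorems.Pcint

open Literature.Probability.Percolation Literature.Probability.LatticeModels

section Automaton

variable {σ α : Type*}

/-- Number of words of length `n` accepted from state `S` whose final state satisfies `P` (recursion on the FIRST letter). [folklore] -/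
def cntP [Fintype α] (step : σ → α → Option σ) (P : σ → Prop) [DecidablePred P] : σ → ℕ → ℕ
  | S, 0 => if P S then 1 else 0
  | S, n + 1 => ∑ a, match step S a with
      | none => 0
      | some T => cntP step P T n

/-- The acceptance-with-predicate condition of a run. [folklore] -/
def AccP (P : σ → Prop) (o : Option σ) : Prop := ∃ T, o = some T ∧ P T

/-- `AccP` is decidable. [folklore] -/
instance (P : σ → Prop) [DecidablePred P] (o : Option σ) : Decidable (AccP P o) := by
  unfold AccP
  cases o with
  | none => exact isFalse (by simp)
  | some T => exact decidable_of_iff (P T) (by simp)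

/-- **Accepted words with a final-state predicate are counted by `cntP`.** [folklore] -/
theorem card_acceptedP_eq_cntP [Fintype α] [DecidableEq α] (step : σ → α → Option σ) (P : σ → Prop) [DecidablePred P] :
    ∀ (n : ℕ) (S : σ), Fintype.card {w : Fin n → α // AccP P (runW step n S w)} = cntP step P S n := by
  intro n
  induction n with
  | zero =>
    intro S
    by_cases hP : P S
    · simp [cntP, runW, AccP, hP]
    · simp [cntP, runW, AccP, hP]
  | succ n ih =>
    intro S
    classical
    have e : {w : Fin (n + 1) → α // AccP P (runW step (n + 1) S w)} ≃
        Σ a : α, {u : Fin n → α // AccP P ((step S a).bind fun T => runW step n T u)} :=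
      { toFun := fun w => ⟨w.1 0, ⟨Fin.tail w.1, by
            have := w.2; rw [runW_succ_eq_tail] at this; exact this⟩⟩
        invFun := fun p => ⟨Fin.cons p.1 p.2.1, by
            rw [runW_succ_eq_tail, Fin.cons_zero, Fin.tail_cons]; exact p.2.2⟩
        left_inv := fun w => by ext1; exact Fin.cons_self_tail w.1
        right_inv := fun p => by
          rcases p with ⟨a, u, hu⟩
          rfl }
    rw [Fintype.card_congr e, Fintype.card_sigma, cntP]
    refine Finset.sum_congr rfl fun a _ => ?_
    cases hS : step S a with
    | none =>
      simp only [Option.bind_none]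
      rw [Fintype.card_eq_zero_iff.2 ⟨fun u => by obtain ⟨T, hT, -⟩ := u.2; exact absurd hT (by simp)⟩]
    | some T =>
      simp only [Option.bind_some]
      convert ih T

end Automaton

variable {d : ℕ}

/-- The predicate "the state remembers a site of age `j`". [folklore] -/
def HasAge (j : ℕ) (S : MState d) : Prop := ∃ q ∈ S, q.2 = j

/-- `HasAge` is decidable. [folklore] -/
instance (j : ℕ) (S : MState d) : Decidable (HasAge j S) := by
  unfold HasAge; infer_instance

/-- **A `(τ−1)`-letter word is a closing self-avoiding word iff the memory-`τ` automaton accepts it into a state that still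
remembers the start** (age `τ − 1`). [folklore] -/
theorem mem_nearWords_iff_runW {τ : ℕ} (hτ : 2 ≤ τ) (w : Fin (τ - 1) → Fin d × Bool) :
    w ∈ MemoryTail.nearWords d τ (τ - 1) ↔ AccP (HasAge (τ - 1)) (runW (mstep τ) (τ - 1) ∅ w) := by
  classical
  unfold MemoryTail.nearWords
  rw [Finset.mem_filter, mem_sawWords]
  constructor
  · rintro ⟨hsaw, hl1⟩
    refine ⟨danger τ w, runW_mstep_of_isMem hτ w (isMem_of_isSAW τ hsaw), ⟨(wordPos w 0 - wordPos w (τ - 1), τ - 1), ?_, rfl⟩⟩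
    rw [mem_danger]
    refine ⟨by omega, le_rfl, le_rfl, by rw [Nat.sub_self], ?_⟩
    show l1 (wordPos w 0 - wordPos w (τ - 1)) ≤ τ - (τ - 1)
    rw [wordPos_zero, zero_sub, l1_neg]
    have : τ - (τ - 1) = 1 := by omega
    rw [this]
    have h2 : τ - (τ - 1) = 1 := this
    calc l1 (wordPos w (τ - 1)) ≤ τ - (τ - 1) := hl1
      _ = 1 := h2
  · rintro ⟨T, hT, q, hq, hq2⟩
    have hsome : (runW (mstep τ) (τ - 1) ∅ w).isSome := by rw [hT]; rfl
    have hmem : IsMem τ w := isMem_of_runW_isSome hτ w hsome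
    have hsaw : IsSAW w := by
      intro i j hi hj hij
      by_contra hne
      rcases Nat.lt_or_gt_of_ne hne with h | h
      · exact hmem i j hj h (by omega) hij
      · exact hmem j i hi h (by omega) hij.symm
    refine ⟨hsaw, ?_⟩
    rw [runW_mstep_of_isMem hτ w hmem, Option.some.injEq] at hT
    rw [← hT, mem_danger] at hq
    obtain ⟨-, -, -, hq1, hql⟩ := hq
    rw [hq2, Nat.sub_self, wordPos_zero, zero_sub] at hq1
    rw [hq1, l1_neg] at hql
    rw [hq2] at hql
    exact hql

/-- **`closingCount d τ = cntP (mstep τ) (HasAge (τ−1)) ∅ (τ−1)`** (`τ ≥ 2`): the closing count as a closed automaton term. [folklore] -/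
theorem closingCount_eq_cntP {τ : ℕ} (hτ : 2 ≤ τ) (d : ℕ) :
    MemoryTail.closingCount d τ = cntP (mstep τ) (HasAge (τ - 1)) (∅ : MState d) (τ - 1) := by
  classical
  unfold MemoryTail.closingCount
  rw [← card_acceptedP_eq_cntP, Fintype.card_subtype]
  congr 1
  ext w
  rw [Finset.mem_filter, mem_nearWords_iff_runW hτ]
  simp

/-! ### Fixing the first letter by symmetry -/

/-- `HasAge` is invariant under the lattice symmetries (they do not touch ages). [folklore] -/
theorem hasAge_smulState (j : ℕ) (g : SPerm d) (S : MState d) : HasAge j (smulState g S) ↔ HasAge j S := by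
  unfold HasAge
  constructor
  · rintro ⟨q, hq, hqj⟩
    obtain ⟨r, hr, -⟩ := (mem_smulState g S q).1 hq
    exact ⟨(r, q.2), hr, hqj⟩
  · rintro ⟨q, hq, hqj⟩
    refine ⟨(smulSite g q.1, q.2), ?_, hqj⟩
    rw [mem_smulState]
    exact ⟨q.1, hq, rfl⟩

/-- **`cntP` with an age predicate is invariant under lattice symmetries.** [folklore] -/
theorem cntP_hasAge_smulState (τ j : ℕ) (g : SPerm d) :
    ∀ (n : ℕ) (S : MState d), cntP (mstep τ) (HasAge j) (smulState g S) n = cntP (mstep τ) (HasAge j) S n := by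
  intro n
  induction n with
  | zero => intro S; simp only [cntP, hasAge_smulState]
  | succ n ih =>
    intro S
    simp only [cntP]
    rw [← Equiv.sum_comp (letterEquiv g)]
    refine Finset.sum_congr rfl fun a _ => ?_
    rw [show letterEquiv g a = smulLetter g a from rfl, mstep_smul]
    cases mstep τ S a with
    | none => rfl
    | some T => exact ih T

/-- The first step from `∅`: every letter is allowed and leaves the single remembered site `−e_a` of age `1` [folklore] -/
theorem mstep_empty (τ : ℕ) (a : Fin d × Bool) :
    mstep τ (∅ : MState d) a = some {(-stepVec a, 1)} := by
  unfold mstep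
  rw [if_neg (by simp)]
  simp

/-- The symmetry `(swap 0 a.1, constant sign a.2)` maps the letter `e₀⁺` to `a`. [folklore] -/
theorem smulLetter_swap_zero [NeZero d] (a : Fin d × Bool) :
    smulLetter ((Equiv.swap (0 : Fin d) a.1, fun _ => a.2) : SPerm d) ((0 : Fin d), true) = a := by
  rcases a with ⟨i, b⟩
  simp only [smulLetter, Equiv.symm_swap, Equiv.swap_apply_left]
  cases b <;> rfl

/-- **First-letter reduction**: `cntP (mstep τ) (HasAge j) ∅ (n+1) = 2d · cntP (mstep τ) (HasAge j) {(−e₀⁺, 1)} n` (`d ≥ 1`) —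
all `2d` one-letter states are symmetric images of one of them. [folklore] -/
theorem cntP_empty_succ [NeZero d] (τ j n : ℕ) :
    cntP (mstep τ) (HasAge j) (∅ : MState d) (n + 1) =
      2 * d * cntP (mstep τ) (HasAge j) ({(-stepVec ((0 : Fin d), true), 1)} : MState d) n := by
  set S₀ : MState d := {(-stepVec ((0 : Fin d), true), 1)} with hS₀
  have hterm : ∀ a : Fin d × Bool, (match mstep τ (∅ : MState d) a with
      | none => 0
      | some T => cntP (mstep τ) (HasAge j) T n) = cntP (mstep τ) (HasAge j) S₀ n := by
    intro a
    rw [mstep_empty τ a]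
    simp only
    set g : SPerm d := (Equiv.swap (0 : Fin d) a.1, fun _ => a.2) with hg
    have hS : ({(-stepVec a, 1)} : MState d) = smulState g S₀ := by
      rw [hS₀, smulState, Finset.image_singleton, ← smulLetter_swap_zero a, stepVec_smulLetter, smulSite_neg]
    rw [hS, cntP_hasAge_smulState]
  simp only [cntP]
  rw [show (2 : ℕ) * d * cntP (mstep τ) (HasAge j) S₀ n = ∑ _a : Fin d × Bool, cntP (mstep τ) (HasAge j) S₀ n by
    rw [Finset.sum_const, Finset.card_univ, Fintype.card_prod, Fintype.card_fin, Fintype.card_bool, smul_eq_mul]; ring]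
  exact Finset.sum_congr rfl fun a _ => hterm a

/-- **`2·6·p_6(ℤ³) = 264`** (`p_6(ℤ³) = 22` hexagons per site): kernel evaluation of the memory-6 automaton over the `6⁴` words
after the first letter. [this work] -/
theorem closingCount_six_zd3 : MemoryTail.closingCount 3 6 = 264 := by
  rw [closingCount_eq_cntP (by norm_num), show (6 : ℕ) - 1 = 4 + 1 from rfl, cntP_empty_succ]
  have h : cntP (mstep 6) (HasAge 5) ({(-stepVec ((0 : Fin 3), true), 1)} : MState 3) 4 = 44 := by
    decide +kernel
  rw [h]

/-- **`2·6·p_6(ℤ⁴) = 912`** (`p_6(ℤ⁴) = 76`): kernel evaluation over the `8⁴` words after the first letter. [this work] -/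
theorem closingCount_six_zd4 : MemoryTail.closingCount 4 6 = 912 := by
  rw [closingCount_eq_cntP (by norm_num), show (6 : ℕ) - 1 = 4 + 1 from rfl, cntP_empty_succ]
  have h : cntP (mstep 6) (HasAge 5) ({(-stepVec ((0 : Fin 4), true), 1)} : MState 4) 4 = 114 := by
    decide +kernel
  rw [h]

/-- `2·4·p_4(ℤ³) = 24` (the unit squares; agrees with `closingCount_four_eq`). [this work] -/
theorem closingCount_four_zd3 : MemoryTail.closingCount 3 4 = 24 := by
  rw [closingCount_eq_cntP (by norm_num), show (4 : ℕ) - 1 = 2 + 1 from rfl, cntP_empty_succ]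
  have h : cntP (mstep 4) (HasAge 3) ({(-stepVec ((0 : Fin 3), true), 1)} : MState 3) 2 = 4 := by
    decide +kernel
  rw [h]

end Summit.CriticalPhenomena.PercolationContinuityZ3.Theorems.Pcint
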